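/-
Copyright: the b2b-balaban cell (near-miss cell 7), T⁴-continuum fan-out, lineage t4-ne7b-p3 (node U5c LARGE-DEVIATION
member P3).  Released under the licence of the surrounding project.
-/
import Literature.MathematicalPhysics.QuantumFieldTheory.Balaban1983to89.T4PrintedShapeBanking
import Summits.QuantumFields.BalabanUV.T4Continuum.Support.SpaceTimeBanking

/-!
# Space-time Peierls ∕ Cramér route for NE7b — leaf A3d WITHOUT RE-INSTANTIATION: the per-cell rate of a lineage's
# contour from print's banking AT ITS OWN BANK `κ₁·W + E` (the COUNT member's landed inhabitation, by name) and the
# volume accounting A3b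

Summits-side support leaf of the T⁴-continuum cell (rung (B)+1 on a FINITE torus only; NOT infinite volume, NOT the
mass gap, NOT the Clay statement; NOT a proof of the spine estimate NE7b).  Lineage `t4-ne7b-p3` (generation 2), node
U5c, skeleton `t4/skeletons/NE7b-t4-ne7b-p3.md` leaf A3d (v1.3.1 «ALTERNATIVE WITHOUT RE-INSTANTIATION»), rows
ST6 ∕ ST7.  [folklore] real arithmetic and finite sums over the row's SHARED genealogy carrier `T4PersistenceDictionary.
Gen`, its banked induction `T4BankedInduction` and the printed-shape data `T4PrintedShapeBanking` (lineage t4-ne7b-p1)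
— all imported BY NAME, nothing modified; nothing is quoted from print and nothing printed is asserted; no `[cite:]` tag.

WHY.  The factor half of the pinned-contour bound (A3, `SpaceTimePinning.factor_of_surplus`) needs a per-term surplus
`income − maint ≥ s · |𝒦|`.  Generation 1 obtained it from BANKING AT HALF CREDIT (`maint ≤ income/2`,
`SpaceTimeBanking.banking_ledgerOfGen`) plus volume-through-maintenance, which left the four `Banking` binders at the
bank `½·credit` to be re-instantiated from the typed flow (row ST7).  This file closes the factor half INSTEAD from the
bank the COUNT member ALREADY inhabits from the typed flow (`T4PrintedShapeBanking.banking_printedShape_of_flow` ∕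
`exists_irThreshold`: bank `κ₁·W e + E e`, `E` = `Eb + μ(d′+1)` at births, `E₀` else): the banked induction gives
`income − maint ≥ Σ_events (κ₁ W e + E e) ≥ κ₁·epochLen + Eb·births + μ·fat` (the BANKED SURPLUS, §1–§2), and the
volume accounting A3b `|𝒦| ≤ C₁·fat + C₂·(epochLen + births)` (`SpaceTimeVolume`) converts it into the per-cell rate
`rateB = min (min κ₁ Eb / C₂) (μ / C₁)` (§1 `surplus_ge_rateB_mul_vol`).  Since `κ₁, Eb, μ` are the cell's to
choose, the route's survival condition `rateB − c₃ > log Δ₁` costs only a larger infrared threshold (file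
`SpaceTimeThreshold`).  Row ST7 (half-credit re-instantiation) is thereby NOT NEEDED.
* §1 ledger level: `ContourLedger.BankedSurplus κ₁ Eb μ`, `rateB`, `surplus_ge_rateB_mul_vol`, `exp_neg_surplus_le_rateB`;
* §2 carrier level (any admissibility `adm`, any event type): `sum_margin_ge` (margins with the birth shape
  `E b ≥ Eb + μ·fat b` sum to `≥ Eb·births + μ·fatSum`), `bankedSurplus_ledgerOfGen` (from ANY
  `Banking adm W cost credit (κ₁·W + E) reserve ext` by `T4BankedInduction.lifeCost_add_banks_le`),
  `surplus_ge_rateB_of_gen`;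
* §3 THE PRINTED-SHAPE INSTANCE on the dictionary (`Consistent`, `dictW`, `cost`, `credit`, `Emarg`, `reserve`, `extn` of
  `T4PrintedShapeBanking`, by name): `surplus_ge_rateB_printedShape` — given the COUNT member's `Banking` (a displayed
  hypothesis here; inhabited in the tree past one infrared threshold) and A3b's volume accounting of the lineage,
  `rateB C.κ₁ C.Eb C.μ C₁ C₂ · vol ≤ credits − lifeCost`.
Every printed shape stays a displayed binder of the COUNT member's modules; nothing of Bałaban's is asserted.

HONEST DEPENDENCY (cell, verbatim): continuum YM on T⁴ ⇐ BetaPertH ∧ nine spine estimates (0/9 proved); BetaPertH ⇐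
(D1) ∧ (D4) ∧ CAP+tail; G-an2-4 gates asym, D1 and NE2/3/4.  This file changes none of it.
-/

open Finset

/-! ## §1 Ledger level: the banked surplus and the rate -/

namespace Summit.QuantumFields.BalabanUV.T4Continuum.SpaceTimePeierlsLeaves

/-- LEAF A3d′ (hypothesis shape at ledger level; DERIVED on the carrier in §2 from print's banking binders): the BANKED
SURPLUS — income exceeds maintenance by the retained banks, `κ₁·epochLen + Eb·births + μ·fat ≤ income − maint`.
[folklore] -/
def ContourLedger.BankedSurplus (κ₁ Eb μ : ℝ) (ℓ : ContourLedger) : Prop :=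
  κ₁ * ℓ.epochLen + Eb * ℓ.births + μ * ℓ.fat ≤ ℓ.income - ℓ.maint

/-- **THE PER-CELL RATE OF THE BANKED ROUTE**: `rateB κ₁ Eb μ C₁ C₂ = min (min κ₁ Eb / C₂) (μ / C₁)` — epochs and births
are paid at `min κ₁ Eb` per `C₂` cells, created fatness at `μ` per `C₁` cells. [folklore] -/
noncomputable def rateB (κ₁ Eb μ C₁ C₂ : ℝ) : ℝ := min (min κ₁ Eb / C₂) (μ / C₁)

/-- the rate is nonnegative for nonnegative constants [folklore] -/
theorem rateB_nonneg {κ₁ Eb μ C₁ C₂ : ℝ} (hκ : 0 ≤ κ₁) (hEb : 0 ≤ Eb) (hμ : 0 ≤ μ) (hC₁ : 0 ≤ C₁) (hC₂ : 0 ≤ C₂) :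
    0 ≤ rateB κ₁ Eb μ C₁ C₂ :=
  le_min (div_nonneg (le_min hκ hEb) hC₂) (div_nonneg hμ hC₁)

/-- the rate dominates a common lower bound of the three per-cell rates: if `T ≤ κ₁/C₂`, `T ≤ Eb/C₂`, `T ≤ μ/C₁` then
`T ≤ rateB`. [folklore] -/
theorem le_rateB {κ₁ Eb μ C₁ C₂ T : ℝ} (hC₂ : 0 < C₂) (h1 : T * C₂ ≤ κ₁) (h2 : T * C₂ ≤ Eb) (h3 : T ≤ μ / C₁) :
    T ≤ rateB κ₁ Eb μ C₁ C₂ :=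
  le_min (by rw [le_div_iff₀ hC₂]; exact le_min h1 h2) h3

/-- **A3b ∧ A3d′ ⇒ THE PER-CELL RATE** (ledger arithmetic, PROVED): volume accounting `vol ≤ C₁·fat + C₂·(epochLen +
births)` and the banked surplus give `rateB · vol ≤ income − maint`. [folklore] -/
theorem ContourLedger.surplus_ge_rateB_mul_vol (ℓ : ContourLedger) {C₁ C₂ κ₁ Eb μ : ℝ} (hC₁ : 0 < C₁)
    (hC₂ : 0 < C₂) (hκ : 0 ≤ κ₁) (hEb : 0 ≤ Eb) (hμ : 0 ≤ μ) (hvol : ℓ.VolumeAccounting C₁ C₂)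
    (hb : ℓ.BankedSurplus κ₁ Eb μ) : rateB κ₁ Eb μ C₁ C₂ * ℓ.vol ≤ ℓ.income - ℓ.maint := by
  set r := rateB κ₁ Eb μ C₁ C₂ with hr
  have hr0 : 0 ≤ r := rateB_nonneg hκ hEb hμ hC₁.le hC₂.le
  have hrC₂ : r * C₂ ≤ min κ₁ Eb := by
    have h : r ≤ min κ₁ Eb / C₂ := min_le_left _ _
    rwa [le_div_iff₀ hC₂] at h
  have hr1 : r * C₂ ≤ κ₁ := hrC₂.trans (min_le_left _ _)
  have hr2 : r * C₂ ≤ Eb := hrC₂.trans (min_le_right _ _)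
  have hr3 : r * C₁ ≤ μ := by
    have h : r ≤ μ / C₁ := min_le_right _ _
    rwa [le_div_iff₀ hC₁] at h
  have hv : (ℓ.vol : ℝ) ≤ C₁ * ℓ.fat + C₂ * (ℓ.epochLen + ℓ.births) := hvol
  have hb' : κ₁ * ℓ.epochLen + Eb * ℓ.births + μ * ℓ.fat ≤ ℓ.income - ℓ.maint := hb
  have hE : (0 : ℝ) ≤ ℓ.epochLen := Nat.cast_nonneg _
  have hB : (0 : ℝ) ≤ ℓ.births := Nat.cast_nonneg _
  have hF : (0 : ℝ) ≤ ℓ.fat := Nat.cast_nonneg _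
  calc r * ℓ.vol ≤ r * (C₁ * ℓ.fat + C₂ * (ℓ.epochLen + ℓ.births)) := mul_le_mul_of_nonneg_left hv hr0
    _ = (r * C₁) * ℓ.fat + (r * C₂) * ℓ.epochLen + (r * C₂) * ℓ.births := by ring
    _ ≤ μ * ℓ.fat + κ₁ * ℓ.epochLen + Eb * ℓ.births :=
        add_le_add (add_le_add (mul_le_mul_of_nonneg_right hr3 hF) (mul_le_mul_of_nonneg_right hr1 hE))
          (mul_le_mul_of_nonneg_right hr2 hB)
    _ ≤ ℓ.income - ℓ.maint := by linarith

/-- … and the exponential form consumed by the factor half of the pinned-contour bound: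
`e^{−(income − maint)} ≤ (e^{−rateB})^{vol}`. [folklore] -/
theorem ContourLedger.exp_neg_surplus_le_rateB (ℓ : ContourLedger) {C₁ C₂ κ₁ Eb μ : ℝ} (hC₁ : 0 < C₁)
    (hC₂ : 0 < C₂) (hκ : 0 ≤ κ₁) (hEb : 0 ≤ Eb) (hμ : 0 ≤ μ) (hvol : ℓ.VolumeAccounting C₁ C₂)
    (hb : ℓ.BankedSurplus κ₁ Eb μ) :
    Real.exp (-(ℓ.income - ℓ.maint)) ≤ Real.exp (-rateB κ₁ Eb μ C₁ C₂) ^ ℓ.vol := by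
  rw [← Real.exp_nat_mul, Real.exp_le_exp]
  have := ℓ.surplus_ge_rateB_mul_vol hC₁ hC₂ hκ hEb hμ hvol hb
  linarith

end Summit.QuantumFields.BalabanUV.T4Continuum.SpaceTimePeierlsLeaves

/-! ## §2 Carrier level: the banked surplus of a genealogy from print's banking at bank `κ₁·W + E` -/

namespace Summit.QuantumFields.BalabanUV.T4Continuum.SpaceTimePeierls

open Literature.MathematicalPhysics.QuantumFieldTheory.Balaban1983to89
open T4PersistenceDictionary T4BankedInduction SpaceTimePeierlsLeaves

noncomputable section

section Carrier

variable {ε : Type*} [DecidableEq ε]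

/-- **THE MARGINS PAY BIRTHS AND FATNESS**: if every margin is nonnegative and every admissible birth's margin has the
shape `E b ≥ Eb + μ·fat b` (the COUNT member's `Emarg` at births: `Eb + μ(d′+1)`), then along every admissible
well-formed genealogy `Eb·#births + μ·fatSum ≤ Σ_events E e`.  Displayed shape binders; nothing printed asserted.
[folklore] -/
theorem sum_margin_ge {adm : Gen ε → Prop} {W : ε → ℕ} {E : ε → ℝ} {fat : ε → ℕ} {Eb μ : ℝ}
    (adm_renew : ∀ G e h, adm (Gen.renew G e h) → adm G)
    (adm_merge : ∀ X Y e, adm (Gen.merge X Y e) → adm X ∧ adm Y)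
    (hE0 : ∀ e, 0 ≤ E e) (hEb : ∀ b j, adm (Gen.born b j) → Eb + μ * fat b ≤ E b) :
    ∀ G : Gen ε, adm G → G.WF W → Eb * nBirths G + μ * fatSum fat G ≤ ∑ e ∈ G.events, E e
  | Gen.born b j, hA, _ => by
      have h := hEb b j hA
      simp only [nBirths, fatSum, Gen.events_born, sum_singleton, Nat.cast_one, mul_one]
      exact h
  | Gen.renew G e h, hA, hW => by
      simp only [Gen.WF] at hW
      obtain ⟨hG, he, -, -⟩ := hW
      have IH := sum_margin_ge adm_renew adm_merge hE0 hEb G (adm_renew G e h hA) hG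
      rw [Gen.events_renew, sum_insert he]
      simp only [nBirths, fatSum]
      linarith [hE0 e]
  | Gen.merge X Y e, hA, hW => by
      simp only [Gen.WF] at hW
      obtain ⟨hX, hY, heX, heY, hXY, -, -⟩ := hW
      have IHX := sum_margin_ge adm_renew adm_merge hE0 hEb X (adm_merge X Y e hA).1 hX
      have IHY := sum_margin_ge adm_renew adm_merge hE0 hEb Y (adm_merge X Y e hA).2 hY
      have he : e ∉ X.events ∪ Y.events := by simp [heX, heY]
      rw [Gen.events_merge, sum_insert he, sum_union hXY]
      simp only [nBirths, fatSum, Nat.cast_add]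
      linarith [hE0 e]

/-- **LEAF A3d′ ON THE CARRIER — THE BANKED SURPLUS FROM PRINT'S BANKING AT BANK `κ₁·W + E`.**  If print's four
window-local binders (`T4BankedInduction.Banking`) hold with the bank `e ↦ κ₁·W e + E e` (margins `E ≥ 0`, births
`E b ≥ Eb + μ·fat b`), then along every admissible well-formed genealogy whose root reserve is nonnegative the ledger
`ledgerOfGen` (fat `:= fatSum`) has the banked surplus `κ₁·epochLen + Eb·births + μ·fat ≤ credits − lifeCost`
(`lifeCost_add_banks_le`, by name).  NOT PRINTED as a statement; kernel modulo the displayed binders. [folklore] -/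
theorem bankedSurplus_ledgerOfGen {adm : Gen ε → Prop} {W : ε → ℕ} {cost : Gen ε → ℕ → ℝ}
    {credit reserve E : ε → ℝ} {ext : Gen ε → Gen ε → ε → ℝ} {fat : ε → ℕ} {κ₁ Eb μ : ℝ}
    (B : Banking adm W cost credit (fun e => κ₁ * (W e : ℝ) + E e) reserve ext)
    (hE0 : ∀ e, 0 ≤ E e) (hEb : ∀ b j, adm (Gen.born b j) → Eb + μ * fat b ≤ E b)
    {G : Gen ε} (hA : adm G) (hG : G.WF W) (hr : 0 ≤ reserve G.root) (vol : ℕ) :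
    (ledgerOfGen W cost credit vol (fatSum fat G) G).BankedSurplus κ₁ Eb μ := by
  have h1 := lifeCost_add_banks_le B hA hG hr
  have h2 := sum_margin_ge (W := W) B.adm_renew B.adm_merge hE0 hEb G hA hG
  have hb : banks (fun e => κ₁ * (W e : ℝ) + E e) G =
      κ₁ * (((∑ e ∈ G.events, W e : ℕ)) : ℝ) + ∑ e ∈ G.events, E e := by
    simp only [banks, sum_add_distrib, ← mul_sum, Nat.cast_sum]
  rw [hb] at h1
  show κ₁ * (((∑ e ∈ G.events, W e : ℕ)) : ℝ) + Eb * ((nBirths G : ℕ) : ℝ) + μ * ((fatSum fat G : ℕ) : ℝ)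
      ≤ credits credit G - lifeCost W cost G
  linarith

/-- **THE PER-CELL RATE OF A GENEALOGY'S CONTOUR, BANKED FORM.**  Print's banking at bank `κ₁·W + E` (margins
`E ≥ 0`, birth shape `E b ≥ Eb + μ·fat b`), a nonnegative root reserve and — for the cell-level volume `vol` of the
contour — the volume accounting A3b (`VolumeAccounting C₁ C₂`, file `SpaceTimeVolume`) give
`rateB κ₁ Eb μ C₁ C₂ · vol ≤ credits − lifeCost`. [folklore] -/
theorem surplus_ge_rateB_of_gen {adm : Gen ε → Prop} {W : ε → ℕ} {cost : Gen ε → ℕ → ℝ}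
    {credit reserve E : ε → ℝ} {ext : Gen ε → Gen ε → ε → ℝ} {fat : ε → ℕ} {κ₁ Eb μ C₁ C₂ : ℝ}
    (B : Banking adm W cost credit (fun e => κ₁ * (W e : ℝ) + E e) reserve ext)
    (hE0 : ∀ e, 0 ≤ E e) (hEb : ∀ b j, adm (Gen.born b j) → Eb + μ * fat b ≤ E b)
    (hκ : 0 ≤ κ₁) (hEb0 : 0 ≤ Eb) (hμ : 0 ≤ μ) (hC₁ : 0 < C₁) (hC₂ : 0 < C₂)
    {G : Gen ε} (hA : adm G) (hG : G.WF W) (hr : 0 ≤ reserve G.root) {vol : ℕ}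
    (hvol : (ledgerOfGen W cost credit vol (fatSum fat G) G).VolumeAccounting C₁ C₂) :
    rateB κ₁ Eb μ C₁ C₂ * vol ≤ credits credit G - lifeCost W cost G :=
  (ledgerOfGen W cost credit vol (fatSum fat G) G).surplus_ge_rateB_mul_vol hC₁ hC₂ hκ hEb0 hμ hvol
    (bankedSurplus_ledgerOfGen B hE0 hEb hA hG hr vol)

end Carrier

/-! ## §3 The printed-shape instance on the dictionary -/

section Printed

open T4PrintedShapeBanking

/-- The root birth of a consistent genealogy happens at a performed step: `rootStep ≤ K`. [folklore] -/
theorem rootStep_le_of_consistent {C : T4PrintedShapeBanking.Consts} {K : ℕ} {R : ℕ → ℕ} :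
    ∀ {G : Gen PEv}, Consistent C K R G → G.rootStep ≤ K
  | Gen.born _ _, hc => by
      simp only [Consistent] at hc
      simpa using hc.2.2
  | Gen.renew G _ _, hc => by
      simp only [Consistent] at hc
      simpa using rootStep_le_of_consistent hc.1
  | Gen.merge X Y _, hc => by
      simp only [Consistent] at hc
      rw [Gen.rootStep_merge]
      exact (min_le_left _ _).trans (rootStep_le_of_consistent hc.1)

/-- **THE PRINTED-SHAPE INSTANCE.**  On the dictionary (`Consistent C K R`, windows `dictW R C.n₁`, costs `cost C K R`,
credits `credit C g`, bank `κ₁·W + Emarg C`, reserves `reserve C g`, extensions `extn C K R` — the COUNT member's data,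
by name): if these inhabit `Banking` (in the tree: `banking_printedShape_of_flow` ∕ `exists_irThreshold`, past one
infrared threshold on `log g_K⁻²` — a displayed hypothesis `B` here), the profile is nonnegative on performed steps
(`0 ≤ A₀`, `0 ≤ log g_s⁻²` for `s ≤ K`), and the contour volume of a consistent well-formed genealogy obeys the volume
accounting A3b, then `rateB C.κ₁ C.Eb C.μ C₁ C₂ · vol ≤ credits − lifeCost`.  The birth margin `Eb + μ(d′+1) ≥ Eb +
μ·d′` and the margins' signs come from `Consts.Valid`. [folklore] -/
theorem surplus_ge_rateB_printedShape {C : T4PrintedShapeBanking.Consts} (hC : C.Valid) {K : ℕ} {R : ℕ → ℕ}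
    {g : ℕ → ℝ}
    (B : Banking (Consistent C K R) (dictW R C.n₁) (cost C K R) (credit C g)
      (fun e => C.κ₁ * ((dictW R C.n₁ e : ℕ) : ℝ) + Emarg C e) (reserve C g) (extn C K R))
    (hA0 : 0 ≤ C.A₀) (hx0 : ∀ s, s ≤ K → 0 ≤ Real.log ((g s) ^ 2)⁻¹) {C₁ C₂ : ℝ} (hC₁ : 0 < C₁)
    (hC₂ : 0 < C₂) {G : Gen PEv} (hc : Consistent C K R G) (hW : G.WF (dictW R C.n₁)) {vol : ℕ}
    (hvol : (ledgerOfGen (dictW R C.n₁) (cost C K R) (credit C g) vol (fatSum PEv.fat G) G).VolumeAccounting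
      C₁ C₂) :
    rateB C.κ₁ C.Eb C.μ C₁ C₂ * vol ≤ credits (credit C g) G - lifeCost (dictW R C.n₁) (cost C K R) G := by
  refine surplus_ge_rateB_of_gen (fat := PEv.fat) B ?_ ?_ hC.κ₁_nonneg hC.Eb_nonneg hC.μ_nonneg hC₁ hC₂ hc hW
    ?_ hvol
  · -- margins are nonnegative
    intro e
    by_cases h : e.kind = 0
    · rw [Emarg_kind0 h]
      have := hC.Eb_nonneg
      have := hC.μ_nonneg
      positivity
    · unfold Emarg
      rw [if_neg h]
      exact hC.E₀_nonneg
  · -- births: kind `0`, margin `Eb + μ(d′+1) ≥ Eb + μ d′`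
    intro b j hb
    simp only [Consistent] at hb
    rw [Emarg_kind0 hb.1]
    nlinarith [hC.μ_nonneg]
  · -- the root reserve `2p₀(g_{rootStep})` is nonnegative (`rootStep ≤ K`)
    have hroot := Consistent.root_spec hc
    rw [reserve_kind0 hroot.1, hroot.2]
    have hK := rootStep_le_of_consistent hc
    unfold p0Profile
    exact mul_nonneg (by norm_num) (mul_nonneg hA0 (pow_nonneg (hx0 _ hK) _))

end Printed

end

end Summit.QuantumFields.BalabanUV.T4Continuum.SpaceTimePeierls
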